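import Mathlib
import Summits.NavierStokesRegularity.NavierStokesRegularity.Theorems.EulerZoomLiouvillePowerGaugeEulerLiouvilleQVorticityIdentity
import HarnessLib

/-!
# The weighted `q`-enstrophy along classical Euler flows — the differential INEQUALITY for outgoing weights
# (helper of the DSS vorticity-decay stratum of the crux `EulerZoomLiouville.PowerGaugeEulerLiouville`,
# route №10, item stmt-NavierStokesRegularity-19832)

Helper file (theorems only; `--supports stmt-NavierStokesRegularity-19832`). Seat ns-typeII-p3 (cell
ns-regularity-ideate §B, D-0081). Sequel of `…QVorticityIdentity.lean`. From the weighted `q`-enstrophy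
balance `½J(T) − ½J(0) = ∫₀ᵀ(∫(q/2)Θ²|ω|^q⟪ξ, Du ξ⟫ + ∫Θ(∂ₜΘ + DΘ[u])|ω|^q)`, `J(σ) = ∫Θ(σ)²|ω(σ)|^q`:
if the weight is nonnegative and OUTGOING (`∂ₜΘ + DΘ[u] ≥ 0`: the material derivative of `Θ` along the
flow is nonnegative) and the velocity gradient is bounded by `κ` on the support of `Θ`, then
(`integral_weight_rpow_ge`) `J(T) ≥ J(0) − q κ ∫₀ᵀ J(σ) dσ`; and `J` is integrable on `(0, T)`
(`integrableOn_weight_rpow`). This is the Eulerian, physical-variable form of the absorption step of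
Chae–Tsai, MRL 21 (2014), proof of Thm 2.2 (there: `|ξ·∇V·ξ| ≤ ½(3/(q(α+1)) − 1)` and
`V_r ≥ −R/(2(α+1))` on the sphere `|y| = R`).

WHAT THIS IS NOT: not NS, not the crux — an a priori inequality for classical Euler flows. [folklore]
-/

noncomputable section

-- the summit and its single problem share the name `NavierStokesRegularity` (D-0017 nested layout)
set_option linter.dupNamespace false

open Set Function Filter Topology MeasureTheory Metric
open scoped NNReal ENNReal InnerProductSpace RealInnerProductSpace

namespace Summit.NavierStokesRegularity.NavierStokesRegularity.Theorems.PowerGaugeEulerLiouville.VorticityDecay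

open Literature.Analysis Literature.Analysis.FluidPDE
open Summit.NavierStokesRegularity.NavierStokesRegularity.Theorems.PowerGaugeEulerLiouville.VorticitySupport

section Ineq

variable {T : ℝ} {v : ℝ → (EuclideanSpace ℝ (Fin 3)) → (EuclideanSpace ℝ (Fin 3))}
  {p : ℝ → (EuclideanSpace ℝ (Fin 3)) → ℝ} {Θ : ℝ → (EuclideanSpace ℝ (Fin 3)) → ℝ}

/-- **Measurability and integrability in time of the weighted `q`-enstrophy** `J(σ) = ∫Θ(σ)²|ω(σ)|^q`
on `(0, T)` (joint continuity of the integrand on `[0, T] × ℝ³`, `|Θ| ≤ 1`, `∫|ω(σ)|^q ≤ N`). [folklore] -/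
theorem integrableOn_weight_rpow (hT : 0 < T) (hv : IsClassicalNSSolutionOn (Icc 0 T) 0 0 v p)
    (hΘ : IsSmoothSpaceTimeOn (Icc 0 T) Θ) (hΘ1 : ∀ σ ∈ Icc 0 T, ∀ y, |Θ σ y| ≤ 1)
    {q : ℝ} (hq : 0 < q) {N : ℝ}
    (hLq : ∀ σ ∈ Icc 0 T, Integrable (fun y => ‖curl (v σ) y‖ ^ q) ∧ ∫ y, ‖curl (v σ) y‖ ^ q ≤ N) :
    IntegrableOn (fun σ => ∫ x, Θ σ x ^ 2 * ‖curl (v σ) x‖ ^ q) (Ioo 0 T) ∧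
      ∀ σ ∈ Icc 0 T, 0 ≤ ∫ x, Θ σ x ^ 2 * ‖curl (v σ) x‖ ^ q ∧ ∫ x, Θ σ x ^ 2 * ‖curl (v σ) x‖ ^ q ≤ N := by
  have hS : UniqueDiffOn ℝ (Icc 0 T) := uniqueDiffOn_Icc hT
  have hΘc : ∀ σ ∈ Icc 0 T, Continuous (Θ σ) := fun σ hσ => (hΘ.contDiff_slice hσ).continuous
  have hΘ2 : ∀ σ ∈ Icc 0 T, ∀ x, |Θ σ x ^ 2| ≤ 1 := fun σ hσ x => by
    rw [abs_pow]; exact pow_le_one₀ (abs_nonneg _) (hΘ1 σ hσ x)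
  have hI0 : ∀ σ ∈ Icc 0 T, Integrable (fun x => Θ σ x ^ 2 * ‖curl (v σ) x‖ ^ q) := fun σ hσ =>
    (hLq σ hσ).1.bdd_mul ((hΘc σ hσ).pow 2).aestronglyMeasurable
      (Eventually.of_forall fun x => by rw [Real.norm_eq_abs]; exact hΘ2 σ hσ x)
  have hbounds : ∀ σ ∈ Icc 0 T, 0 ≤ ∫ x, Θ σ x ^ 2 * ‖curl (v σ) x‖ ^ q ∧
      ∫ x, Θ σ x ^ 2 * ‖curl (v σ) x‖ ^ q ≤ N := by
    intro σ hσ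
    refine ⟨integral_nonneg fun x => mul_nonneg (sq_nonneg _) (Real.rpow_nonneg (norm_nonneg _) _), ?_⟩
    refine (integral_mono (hI0 σ hσ) (hLq σ hσ).1 fun x => ?_).trans (hLq σ hσ).2
    have h0 : 0 ≤ ‖curl (v σ) x‖ ^ q := Real.rpow_nonneg (norm_nonneg _) _
    have h1 : Θ σ x ^ 2 ≤ 1 := (le_abs_self _).trans (hΘ2 σ hσ x)
    simpa using mul_le_mul_of_nonneg_right h1 h0
  refine ⟨?_, hbounds⟩
  -- measurability in `σ`: the integrand is jointly continuous on `[0, T] × ℝ³`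
  have hcontω : ContinuousOn (fun z : ℝ × (EuclideanSpace ℝ (Fin 3)) => curl (v z.1) z.2) (Icc 0 T ×ˢ univ) := by
    have := (hv.smooth_velocity.isSmoothSpaceTimeOn_vorticity hS).continuousOn
    exact this
  have hcontF : ContinuousOn (fun z : ℝ × (EuclideanSpace ℝ (Fin 3)) => Θ z.1 z.2 ^ 2 * ‖curl (v z.1) z.2‖ ^ q)
      (Icc 0 T ×ˢ univ) :=
    (ContinuousOn.pow hΘ.continuousOn 2).mul (hcontω.norm.rpow_const fun _ _ => Or.inr hq.le)
  have hFm : AEStronglyMeasurable (fun z : ℝ × (EuclideanSpace ℝ (Fin 3)) => Θ z.1 z.2 ^ 2 * ‖curl (v z.1) z.2‖ ^ q)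
      (((volume : Measure ℝ).restrict (Icc 0 T)).prod (volume : Measure (EuclideanSpace ℝ (Fin 3)))) := by
    have h := hcontF.aestronglyMeasurable (μ := (volume : Measure ℝ).prod (volume : Measure (EuclideanSpace ℝ (Fin 3))))
      (measurableSet_Icc.prod MeasurableSet.univ)
    rw [← Measure.restrict_univ (μ := (volume : Measure (EuclideanSpace ℝ (Fin 3)))), Measure.prod_restrict]
    exact h
  have hJm : AEStronglyMeasurable (fun σ => ∫ x, Θ σ x ^ 2 * ‖curl (v σ) x‖ ^ q)
      ((volume : Measure ℝ).restrict (Icc 0 T)) := hFm.integral_prod_right'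
  have hJmI : AEStronglyMeasurable (fun σ => ∫ x, Θ σ x ^ 2 * ‖curl (v σ) x‖ ^ q)
      ((volume : Measure ℝ).restrict (Ioo 0 T)) :=
    hJm.mono_measure (Measure.restrict_mono Ioo_subset_Icc_self le_rfl)
  refine Integrable.mono' (integrableOn_const (C := N) (by simp)) hJmI ?_
  rw [ae_restrict_iff' measurableSet_Ioo]
  refine Eventually.of_forall fun σ hσ => ?_
  have hσ' : σ ∈ Icc 0 T := Ioo_subset_Icc_self hσ
  rw [Real.norm_of_nonneg (hbounds σ hσ').1]
  exact (hbounds σ hσ').2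

/-- **The weighted `q`-enstrophy inequality for nonnegative OUTGOING weights.** For a classical Euler flow
on `[0, T]` (`T > 0`) with `‖u‖, ‖∇u‖ ≤ B`, a jointly smooth weight `Θ` with `0 ≤ Θ ≤ 1`,
`|∂ₜΘ|, ‖DΘ‖ ≤ M`, `∂ₜΘ + DΘ[u] ≥ 0` (outgoing) and `‖∇u(σ, y)‖ ≤ κ` wherever `Θ(σ, y) ≠ 0`, an exponent
`q > 0` and `∫|ω(σ)|^q ≤ N` on `[0, T]`:
`∫Θ(T)²|ω(T)|^q ≥ ∫Θ(0)²|ω(0)|^q − q κ ∫₀ᵀ ∫Θ(σ)²|ω(σ)|^q dσ`. [folklore] -/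
theorem integral_weight_rpow_ge (hT : 0 < T) (hv : IsClassicalNSSolutionOn (Icc 0 T) 0 0 v p)
    {B : ℝ} (hB : ∀ σ ∈ Icc 0 T, ∀ y, ‖v σ y‖ ≤ B ∧ ‖fderiv ℝ (v σ) y‖ ≤ B)
    (hΘ : IsSmoothSpaceTimeOn (Icc 0 T) Θ) {M : ℝ}
    (hΘM : ∀ σ ∈ Icc 0 T, ∀ y, |Θ σ y| ≤ 1 ∧
      |FluidPDE.timeDerivWithin (Icc 0 T) Θ σ y| ≤ M ∧ ‖fderiv ℝ (Θ σ) y‖ ≤ M)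
    (hΘ0 : ∀ σ ∈ Icc 0 T, ∀ y, 0 ≤ Θ σ y)
    (hout : ∀ σ ∈ Icc 0 T, ∀ y, 0 ≤ FluidPDE.timeDerivWithin (Icc 0 T) Θ σ y + fderiv ℝ (Θ σ) y (v σ y))
    {κ : ℝ} (hκ0 : 0 ≤ κ) (hκ : ∀ σ ∈ Icc 0 T, ∀ y, Θ σ y ≠ 0 → ‖fderiv ℝ (v σ) y‖ ≤ κ)
    {q : ℝ} (hq : 0 < q) {N : ℝ}
    (hLq : ∀ σ ∈ Icc 0 T, Integrable (fun y => ‖curl (v σ) y‖ ^ q) ∧ ∫ y, ‖curl (v σ) y‖ ^ q ≤ N) :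
    (∫ x, Θ 0 x ^ 2 * ‖curl (v 0) x‖ ^ q) -
        q * κ * (∫ σ in Ioo 0 T, ∫ x, Θ σ x ^ 2 * ‖curl (v σ) x‖ ^ q) ≤
      ∫ x, Θ T x ^ 2 * ‖curl (v T) x‖ ^ q := by
  have hS : UniqueDiffOn ℝ (Icc 0 T) := uniqueDiffOn_Icc hT
  have hid := integral_weight_rpow_sub_eq hT hv hB hΘ hΘM hq hLq
  obtain ⟨hJ, hJb⟩ := integrableOn_weight_rpow hT hv hΘ (fun σ hσ y => (hΘM σ hσ y).1) hq hLq
  -- continuity / integrability data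
  have hvc : ∀ σ ∈ Icc 0 T, Continuous (v σ) := fun σ hσ => (hv.contDiff_velocity hσ).continuous
  have hωc : ∀ σ ∈ Icc 0 T, Continuous (curl (v σ)) := fun σ hσ =>
    (contDiff_curl (n := 0) ((hv.contDiff_velocity hσ).of_le (by norm_cast))).continuous
  have hAc : ∀ σ ∈ Icc 0 T, Continuous (fun x => fderiv ℝ (v σ) x) := fun σ hσ =>
    (hv.contDiff_velocity hσ).continuous_fderiv (by simp)
  have hΘc : ∀ σ ∈ Icc 0 T, Continuous (Θ σ) := fun σ hσ => (hΘ.contDiff_slice hσ).continuous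
  have hΘ2 : ∀ σ ∈ Icc 0 T, ∀ x, |Θ σ x ^ 2| ≤ 1 := fun σ hσ x => by
    rw [abs_pow]; exact pow_le_one₀ (abs_nonneg _) (hΘM σ hσ x).1
  have hI0 : ∀ σ ∈ Icc 0 T, Integrable (fun x => Θ σ x ^ 2 * ‖curl (v σ) x‖ ^ q) := fun σ hσ =>
    (hLq σ hσ).1.bdd_mul ((hΘc σ hσ).pow 2).aestronglyMeasurable
      (Eventually.of_forall fun x => by rw [Real.norm_eq_abs]; exact hΘ2 σ hσ x)
  have hstc : ∀ σ ∈ Icc 0 T, Continuous (fun x => ‖curl (v σ) x‖ ^ q *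
      ⟪‖curl (v σ) x‖⁻¹ • curl (v σ) x, fderiv ℝ (v σ) x (‖curl (v σ) x‖⁻¹ • curl (v σ) x)⟫) := by
    intro σ hσ
    have h := (continuous_qstretch hq).comp ((hωc σ hσ).prodMk (hAc σ hσ))
    exact h.congr fun x => rfl
  have hIst : ∀ σ ∈ Icc 0 T, Integrable (fun x => ‖curl (v σ) x‖ ^ q *
      ⟪‖curl (v σ) x‖⁻¹ • curl (v σ) x, fderiv ℝ (v σ) x (‖curl (v σ) x‖⁻¹ • curl (v σ) x)⟫) := by
    intro σ hσ
    refine Integrable.mono' ((hLq σ hσ).1.const_mul B) (hstc σ hσ).aestronglyMeasurable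
      (Eventually.of_forall fun x => ?_)
    rw [Real.norm_eq_abs]
    exact (abs_qstretch_le q _ _).trans (mul_le_mul_of_nonneg_right (hB σ hσ x).2
      (Real.rpow_nonneg (norm_nonneg _) _))
  have hI1 : ∀ σ ∈ Icc 0 T, Integrable (fun x => (q / 2 * Θ σ x ^ 2) * (‖curl (v σ) x‖ ^ q *
      ⟪‖curl (v σ) x‖⁻¹ • curl (v σ) x, fderiv ℝ (v σ) x (‖curl (v σ) x‖⁻¹ • curl (v σ) x)⟫)) :=
    fun σ hσ => (hIst σ hσ).bdd_mul ((continuous_const.mul ((hΘc σ hσ).pow 2)).aestronglyMeasurable)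
      (Eventually.of_forall fun x => by
        rw [Real.norm_eq_abs, abs_mul, abs_of_pos (by positivity : (0 : ℝ) < q / 2)]
        exact mul_le_mul_of_nonneg_left (hΘ2 σ hσ x) (by positivity))
  -- pointwise lower bound for the two source terms at each time
  have hlow : ∀ σ ∈ Icc 0 T,
      -(q / 2 * κ) * (∫ x, Θ σ x ^ 2 * ‖curl (v σ) x‖ ^ q) ≤
        (∫ x, (q / 2 * Θ σ x ^ 2) * (‖curl (v σ) x‖ ^ q *
          ⟪‖curl (v σ) x‖⁻¹ • curl (v σ) x, fderiv ℝ (v σ) x (‖curl (v σ) x‖⁻¹ • curl (v σ) x)⟫)) +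
        ∫ x, (Θ σ x * (FluidPDE.timeDerivWithin (Icc 0 T) Θ σ x + fderiv ℝ (Θ σ) x (v σ x))) *
          ‖curl (v σ) x‖ ^ q := by
    intro σ hσ
    have h2 : 0 ≤ ∫ x, (Θ σ x * (FluidPDE.timeDerivWithin (Icc 0 T) Θ σ x + fderiv ℝ (Θ σ) x (v σ x))) *
        ‖curl (v σ) x‖ ^ q :=
      integral_nonneg fun x => mul_nonneg (mul_nonneg (hΘ0 σ hσ x) (hout σ hσ x))
        (Real.rpow_nonneg (norm_nonneg _) _)
    have h1 : -(q / 2 * κ) * (∫ x, Θ σ x ^ 2 * ‖curl (v σ) x‖ ^ q) ≤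
        ∫ x, (q / 2 * Θ σ x ^ 2) * (‖curl (v σ) x‖ ^ q *
          ⟪‖curl (v σ) x‖⁻¹ • curl (v σ) x, fderiv ℝ (v σ) x (‖curl (v σ) x‖⁻¹ • curl (v σ) x)⟫) := by
      rw [← integral_const_mul]
      refine integral_mono ((hI0 σ hσ).const_mul _) (hI1 σ hσ) fun x => ?_
      beta_reduce
      have hq0 : 0 ≤ ‖curl (v σ) x‖ ^ q := Real.rpow_nonneg (norm_nonneg _) _
      by_cases hΘx : Θ σ x = 0
      · simp [hΘx]
      · have hst := (abs_le.1 ((abs_qstretch_le q (curl (v σ) x) (fderiv ℝ (v σ) x)).trans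
          (mul_le_mul_of_nonneg_right (hκ σ hσ x hΘx) hq0))).1
        have hΘsq : 0 ≤ q / 2 * Θ σ x ^ 2 := by positivity
        calc -(q / 2 * κ) * (Θ σ x ^ 2 * ‖curl (v σ) x‖ ^ q)
            = (q / 2 * Θ σ x ^ 2) * (-(κ * ‖curl (v σ) x‖ ^ q)) := by ring
          _ ≤ _ := mul_le_mul_of_nonneg_left hst hΘsq
    linarith
  -- integrate in time
  set g : ℝ → ℝ := fun σ => (∫ x, (q / 2 * Θ σ x ^ 2) * (‖curl (v σ) x‖ ^ q *
      ⟪‖curl (v σ) x‖⁻¹ • curl (v σ) x, fderiv ℝ (v σ) x (‖curl (v σ) x‖⁻¹ • curl (v σ) x)⟫)) +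
    ∫ x, (Θ σ x * (FluidPDE.timeDerivWithin (Icc 0 T) Θ σ x + fderiv ℝ (Θ σ) x (v σ x))) *
      ‖curl (v σ) x‖ ^ q with hg
  have hJint : ∫ σ in Ioo 0 T, -(q / 2 * κ) * (∫ x, Θ σ x ^ 2 * ‖curl (v σ) x‖ ^ q) =
      -(q / 2 * κ) * ∫ σ in Ioo 0 T, ∫ x, Θ σ x ^ 2 * ‖curl (v σ) x‖ ^ q := integral_const_mul _ _
  have hstep : -(q / 2 * κ) * (∫ σ in Ioo 0 T, ∫ x, Θ σ x ^ 2 * ‖curl (v σ) x‖ ^ q) ≤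
      ∫ σ in Ioo 0 T, g σ := by
    by_cases hgi : IntegrableOn g (Ioo 0 T)
    · rw [← hJint]
      refine setIntegral_mono_on (hJ.const_mul _) hgi measurableSet_Ioo fun σ hσ => ?_
      exact hlow σ (Ioo_subset_Icc_self hσ)
    · rw [integral_undef hgi]
      have h0 : 0 ≤ ∫ σ in Ioo 0 T, ∫ x, Θ σ x ^ 2 * ‖curl (v σ) x‖ ^ q :=
        setIntegral_nonneg measurableSet_Ioo fun σ hσ => (hJb σ (Ioo_subset_Icc_self hσ)).1
      have : 0 ≤ q / 2 * κ := by positivity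
      nlinarith
  have hid' : 2⁻¹ * (∫ x, Θ T x ^ 2 * ‖curl (v T) x‖ ^ q) - 2⁻¹ * (∫ x, Θ 0 x ^ 2 * ‖curl (v 0) x‖ ^ q) =
      ∫ σ in Ioo 0 T, g σ := by rw [hid]
  nlinarith [hstep, hid']

end Ineq

end Summit.NavierStokesRegularity.NavierStokesRegularity.Theorems.PowerGaugeEulerLiouville.VorticityDecay

end
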